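import Literature.NumberTheory.EllipticCurves.ModularSymbolsControlSurjective
import HarnessLib

/-!
# Ordinary eigensymbols are measure-valued, I: the masses

For a unit-eigenvalue `U_p`-eigensymbol `Φ̂ ∈ Symb_{Γ₀(N)}(D̂_k)` (`ModularSymbolsControlSurjective.hatDist`,
`p ∣ N`) we construct, for every pair of cusps `(x, y)`, GENUINE level data on `ℤ_p`,
`μ_{x,y}(b + pⁿℤ_p) = u⁻ⁿ · m₀((Φ̂|β_{b,n})(x, y))`, `β_{b,n} = (1 b; 0 pⁿ)` (`ordMass`), where the total
mass `m₀` (and every moment of order `≤ k`) is a well defined linear form on `D̂_k = lim 𝔻⁰_k/F^N`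
(`hatMoment`), and prove that it is a `ℤ_p`-valued MEASURE (`ordMass_mem_distributionsInt`):
additivity over the fibres of `ℤ/pⁿ⁺¹ → ℤ/pⁿ` is the eigen-relation `u·Φ̂|β_{b,n} = Σ_j Φ̂|β_{b+jpⁿ,n+1}`
(`smul_slash_betaMat_eq_sum`, from `β_j β_{b,n} = β_{b+jpⁿ,n+1}`) together with the invariance of the
total mass under the upper-triangular `β`'s (`hatMoment_zero_ρ_betaMat`).  This is the slope-`0` case
of the Amice–Vélu / Višik admissibility argument (Mazur–Tate–Teitelbaum 1986, §I.11; Greenberg–Stevens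
1993, proof of Thm. 1.10): the values of an ORDINARY overconvergent eigensymbol are bounded measures.
The identification of `μ_{x,y}` with `Φ̂(x,y)` inside `D̂_k` is the next brick.

Brick B3e-S4a of the bottom-up plan recorded with the named fact
`greenbergStevens_kitagawa_twoVariable_interpolation_allBranches`.  Everything is proved; no named facts.

## References

* B. Mazur, J. Tate, J. Teitelbaum, Invent. Math. 84 (1986), §I.11. [MazurTateTeitelbaum1986Invent]
* R. Greenberg, G. Stevens, Invent. Math. 111 (1993), §1, Thm. 1.10. [GreenbergStevens1993]
* M. Greenberg, Israel J. Math. 161 (2007), §4. [Greenberg2007Lifting]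
-/

noncomputable section

open scoped MatrixGroups
open Matrix CongruenceSubgroup

namespace Literature.NumberTheory.EllipticCurves

open ModularForms ModularForms.HidaCohomology

variable {p : ℕ} [Fact p.Prime]

/-! ### Moments of order `≤ k` on `D̂_k` -/

section Moments

variable (p) in
/-- The `i`-th moment as a `ℤ_p`-linear form on `𝔻⁰`. [folklore] -/
def momentₗ (i : ℕ) : DInt p →ₗ[ℤ_[p]] ℚ_[p] where
  toFun μ := moment μ.1 i
  map_add' μ ν := moment_add μ.2.1 ν.2.1 i
  map_smul' c μ := by
    rw [RingHom.id_apply]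
    exact (moment_smul μ.2.1 c i).trans (by rw [Algebra.smul_def, PadicInt.algebraMap_apply])

/-- Unfolding `momentₗ`. [folklore] -/
@[simp] theorem momentₗ_apply (i : ℕ) (μ : DInt p) : momentₗ p i μ = moment μ.1 i := rfl

/-- `F^n` is killed by the moments of order `≤ k`. [cite: Greenberg2007Lifting, §3] -/
theorem filGInt_le_ker_momentₗ {k i : ℕ} (hi : i ≤ k) (n : ℕ) : filGInt p k n ≤ LinearMap.ker (momentₗ p i) :=
  fun _ hμ => (mem_filG_iff.mp ((mem_filGInt_iff (p := p)).mp hμ)).2.1 i hi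

variable (p) in
/-- **The `i`-th moment (`i ≤ k`) as a linear form on `D̂_k`**, read off at level `0`. [cite: Greenberg2007Lifting, §3] -/
def hatMoment (k i : ℕ) (hi : i ≤ k) : HatD p k →ₗ[ℤ_[p]] ℚ_[p] :=
  ((filGInt p k 0).liftQ (momentₗ p i) (filGInt_le_ker_momentₗ hi 0)).comp
    (CoeffActionOn.projHat (filGInt_antitone (p := p) k) 0)

/-- `hatMoment` through ANY level: if the level-`n` component of `x` is the class of `μ`, the moment is that of `μ`.
[folklore] -/
theorem hatMoment_eq_of_proj {k i : ℕ} (hi : i ≤ k) (x : HatD p k) (n : ℕ) (μ : DInt p)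
    (hx : x.1 n = Submodule.Quotient.mk μ) : hatMoment p k i hi x = moment μ.1 i := by
  have h0 : x.1 0 = Submodule.Quotient.mk μ := by
    rw [← x.2 0 n (Nat.zero_le n), hx, CoeffActionOn.transQ_mk]
  change (filGInt p k 0).liftQ (momentₗ p i) (filGInt_le_ker_momentₗ hi 0) (x.1 0) = _
  rw [h0, Submodule.liftQ_apply, momentₗ_apply]

/-- `hatMoment` on the diagonal image of a measure. [folklore] -/
theorem hatMoment_toHat {k i : ℕ} (hi : i ≤ k) (μ : DInt p) :
    hatMoment p k i hi (CoeffActionOn.toHat (filGInt_antitone (p := p) k) μ) = moment μ.1 i :=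
  hatMoment_eq_of_proj hi _ 0 μ rfl

/-- **Integrality**: `‖m_i(x)‖ ≤ 1` on `D̂_k`. [folklore] -/
theorem norm_hatMoment_le_one {k i : ℕ} (hi : i ≤ k) (x : HatD p k) : ‖hatMoment p k i hi x‖ ≤ 1 := by
  obtain ⟨μ, hμ⟩ := Submodule.Quotient.mk_surjective _ (x.1 0)
  rw [hatMoment_eq_of_proj hi x 0 μ hμ.symm]
  exact norm_moment_le_one μ.2 i

end Moments

/-! ### The matrices `β_{b,n} = (1 b; 0 pⁿ)` -/

section Beta

variable (p) in
/-- `β_{b,n} = (1 b; 0 pⁿ)`. [cite: MazurTateTeitelbaum1986Invent, §I.11] -/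
def betaMat (n : ℕ) (b : ℕ) : Matrix (Fin 2) (Fin 2) ℤ := !![1, (b : ℤ); 0, (p : ℤ) ^ n]

omit [Fact p.Prime] in
/-- Entry `(0,0)` of `β_{b,n}`. [folklore] -/
@[simp] theorem betaMat_apply00 (n b : ℕ) : betaMat p n b 0 0 = 1 := rfl

omit [Fact p.Prime] in
/-- Entry `(0,1)` of `β_{b,n}`. [folklore] -/
@[simp] theorem betaMat_apply01 (n b : ℕ) : betaMat p n b 0 1 = b := rfl

omit [Fact p.Prime] in
/-- Entry `(1,0)` of `β_{b,n}`. [folklore] -/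
@[simp] theorem betaMat_apply10 (n b : ℕ) : betaMat p n b 1 0 = 0 := rfl

omit [Fact p.Prime] in
/-- Entry `(1,1)` of `β_{b,n}`. [folklore] -/
@[simp] theorem betaMat_apply11 (n b : ℕ) : betaMat p n b 1 1 = (p : ℤ) ^ n := rfl

omit [Fact p.Prime] in
/-- `det β_{b,n} = pⁿ`. [folklore] -/
theorem det_betaMat (n b : ℕ) : (betaMat p n b).det = (p : ℤ) ^ n := by
  rw [betaMat, Matrix.det_fin_two_of]; ring

/-- `det β_{b,n} ≠ 0`. [folklore] -/
theorem det_betaMat_ne_zero (n b : ℕ) : (betaMat p n b).det ≠ 0 := by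
  rw [det_betaMat]; exact pow_ne_zero _ (by exact_mod_cast (Fact.out : p.Prime).ne_zero)

/-- `β_{b,n} ∈ Σ₀(N)`. [folklore] -/
theorem betaMat_mem_sigma0Set (N n b : ℕ) : betaMat p n b ∈ sigma0Set N :=
  ⟨det_betaMat_ne_zero n b, by simp, by rw [betaMat_apply00]; exact isCoprime_one_left⟩

omit [Fact p.Prime] in
/-- `β_{0,0} = 1`. [folklore] -/
theorem betaMat_zero_zero : betaMat p 0 0 = 1 := by
  rw [betaMat]; ext i j; fin_cases i <;> fin_cases j <;> simp

omit [Fact p.Prime] in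
/-- **`β_j · β_{b,n} = β_{b + j pⁿ, n+1}`.** [cite: MazurTateTeitelbaum1986Invent, §I.11] -/
theorem heckeRep_some_mul_betaMat (j : ZMod p) (n b : ℕ) :
    heckeRep p (some j) * betaMat p n b = betaMat p (n + 1) (b + j.val * p ^ n) := by
  rw [heckeRep, betaMat, betaMat]
  ext i l
  fin_cases i <;> fin_cases l
  · simp [Matrix.mul_apply, Fin.sum_univ_two]
  · simp [Matrix.mul_apply, Fin.sum_univ_two]
  · simp [Matrix.mul_apply, Fin.sum_univ_two]
  · simp only [Matrix.mul_apply, Fin.sum_univ_two]; simp [pow_succ, mul_comm]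

end Beta

/-! ### Invariance of the total mass under the `β`'s -/

section Mass

variable {k : ℕ}

/-- `m₀(μ|β_{b,n}) = m₀(μ)` on measures. [folklore] -/
theorem moment_zero_distρInt_betaMat (n b : ℕ) (μ : DInt p) :
    moment (distρInt p k (betaMat p n b) μ).1 0 = moment μ.1 0 := by
  have hM := betaMat_mem_sigma0Set (p := p) p n b
  have hent := norm_entries_of_mem_sigma0Set (dvd_refl p) hM
  have ha1 : ‖(1 : ℤ_[p])‖ = 1 := norm_one
  rw [distρInt_val_eq_weightActD k (dvd_refl p) hM μ,
    weightActD_congr k hent.1 hent.2 ha1 norm_zero_lt_one' (by simp) rfl (by simp) rfl,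
    moment_weightActD_upper k 0 ha1]
  simp

variable {N : ℕ} (hpN : p ∣ N)

/-- **`m₀(ρ̂(β_{b,n}) x) = m₀(x)` on `D̂_k`.** [folklore] -/
theorem hatMoment_zero_ρ_betaMat (n b : ℕ) (x : HatD p k) :
    hatMoment p k 0 (Nat.zero_le k) ((hatDist p k N hpN).ρ (betaMat p n b) x) = hatMoment p k 0 (Nat.zero_le k) x := by
  obtain ⟨μ, hμ⟩ := Submodule.Quotient.mk_surjective _ (x.1 0)
  have hM : betaMat p n b ∈ sigma0Set N := betaMat_mem_sigma0Set N n b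
  have hρ : ((hatDist p k N hpN).ρ (betaMat p n b) x).1 0 = Submodule.Quotient.mk (distρInt p k (betaMat p n b) μ) := by
    change (((distCoeffInt p k N hpN).hat (sigma0Set_mulClosed N) (isInvariant_filGInt k N hpN) (filGInt_antitone k)).ρ
      (betaMat p n b) x).1 0 = _
    rw [(distCoeffInt p k N hpN).hat_ρ_val (sigma0Set_mulClosed N) (isInvariant_filGInt k N hpN) (filGInt_antitone k) hM x 0,
      ← hμ, (distCoeffInt p k N hpN).quotientρ_mk (isInvariant_filGInt k N hpN 0) hM, distCoeffInt_ρ]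
  rw [hatMoment_eq_of_proj _ _ 0 _ hρ, hatMoment_eq_of_proj _ x 0 μ hμ.symm]
  exact moment_zero_distρInt_betaMat n b μ

end Mass

/-! ### The eigen-relation along the `β`'s -/

section Eigen

variable [NeZero p] {k N : ℕ} (u : ℤ_[p]ˣ)

omit [Fact p.Prime] in
/-- For `p ∣ N`, `U_p = Σ_{j mod p} (·)|β_j`. [folklore] -/
theorem hecke_eq_sum_some (hpN : p ∣ N) {S : Set (Matrix (Fin 2) (Fin 2) ℤ)} {R V : Type*} [CommRing R] [AddCommGroup V]
    [Module R V] (A : CoeffActionOn S R V) (Φ : P1Q → P1Q → V) :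
    A.hecke N p Φ = ∑ j : ZMod p, A.slash (heckeRep p (some j)) Φ := by
  rw [A.hecke_apply, sum_heckeIdx N p (fun i => A.slash (heckeRep p i) Φ), if_pos hpN, add_zero]

/-- **`u · Φ̂|β_{b,n} = Σ_j Φ̂|β_{b + j pⁿ, n+1}`** for a `U_p`-eigensymbol `U_p Φ̂ = u Φ̂`.
[cite: MazurTateTeitelbaum1986Invent, §I.11] -/
theorem smul_slash_betaMat_eq_sum (hpN : p ∣ N) {V : Type*} [AddCommGroup V] [Module ℤ_[p] V]
    (A : CoeffActionOn (sigma0Set N) ℤ_[p] V) {Φ : P1Q → P1Q → V} (heig : A.hecke N p Φ = (u : ℤ_[p]) • Φ) (n b : ℕ) :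
    (u : ℤ_[p]) • A.slash (betaMat p n b) Φ = ∑ j : ZMod p, A.slash (betaMat p (n + 1) (b + j.val * p ^ n)) Φ := by
  rw [← map_smul, ← heig, hecke_eq_sum_some hpN A Φ, map_sum]
  refine Finset.sum_congr rfl fun j _ => ?_
  have hdet : (heckeRep p (some j)).det ≠ 0 := by rw [det_heckeRep]; exact_mod_cast (Fact.out : p.Prime).ne_zero
  rw [← LinearMap.comp_apply, ← A.slash_mul (heckeRep_mem_sigma0Set (N := N) Fact.out ⟨some j, fun h => absurd h (by simp)⟩)
    (betaMat_mem_sigma0Set N n b) hdet (det_betaMat_ne_zero n b), heckeRep_some_mul_betaMat]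

end Eigen

/-! ### The fibres of `ℤ/pⁿ⁺¹ → ℤ/pⁿ` -/

section Fibre

variable [NeZero p]

omit [Fact p.Prime] in
/-- The canonical lift `b + j pⁿ` has the expected value. [folklore] -/
theorem val_natCast_add_mul_pow (n : ℕ) (b : ZMod (p ^ n)) (j : ZMod p) :
    ((b.val + j.val * p ^ n : ℕ) : ZMod (p ^ (n + 1))).val = b.val + j.val * p ^ n := by
  haveI : NeZero (p ^ n) := ⟨pow_ne_zero _ (NeZero.ne p)⟩
  rw [ZMod.val_natCast, Nat.mod_eq_of_lt]
  have hb := ZMod.val_lt b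
  have hj := ZMod.val_lt j
  calc b.val + j.val * p ^ n < p ^ n + j.val * p ^ n := by omega
    _ = (j.val + 1) * p ^ n := by ring
    _ ≤ p * p ^ n := Nat.mul_le_mul_right _ hj
    _ = p ^ (n + 1) := by ring

omit [Fact p.Prime] in
/-- The canonical lift lies in the fibre. [folklore] -/
theorem castHom_natCast_add_mul_pow (n : ℕ) (b : ZMod (p ^ n)) (j : ZMod p) :
    ZMod.castHom (pow_dvd_pow p n.le_succ) (ZMod (p ^ n)) ((b.val + j.val * p ^ n : ℕ) : ZMod (p ^ (n + 1))) = b := by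
  haveI : NeZero (p ^ n) := ⟨pow_ne_zero _ (NeZero.ne p)⟩
  rw [map_natCast, Nat.cast_add, ZMod.natCast_zmod_val, Nat.cast_mul, ZMod.natCast_self, mul_zero, add_zero]

omit [Fact p.Prime] in
/-- **Summing over the fibre of `c` under `ℤ/pⁿ⁺¹ → ℤ/pⁿ` is summing over the lifts `c + j pⁿ`, `j mod p`.**
[folklore] -/
theorem sum_fiber_castHom_eq_sum_zmod {M : Type*} [AddCommMonoid M] (n : ℕ) (c : ZMod (p ^ n))
    (g : ZMod (p ^ (n + 1)) → M) :
    ∑ b ∈ Finset.univ.filter (fun b : ZMod (p ^ (n + 1)) => ZMod.castHom (pow_dvd_pow p n.le_succ) (ZMod (p ^ n)) b = c), g b =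
      ∑ j : ZMod p, g ((c.val + j.val * p ^ n : ℕ) : ZMod (p ^ (n + 1))) := by
  haveI : NeZero (p ^ n) := ⟨pow_ne_zero _ (NeZero.ne p)⟩
  haveI : NeZero (p ^ (n + 1)) := ⟨pow_ne_zero _ (NeZero.ne p)⟩
  have hpn : 0 < p ^ n := Nat.pos_of_ne_zero (NeZero.ne _)
  symm
  refine Finset.sum_nbij' (fun j : ZMod p => ((c.val + j.val * p ^ n : ℕ) : ZMod (p ^ (n + 1))))
    (fun b : ZMod (p ^ (n + 1)) => ((b.val / p ^ n : ℕ) : ZMod p)) (fun j _ => ?_) (fun _ _ => Finset.mem_univ _)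
    (fun j _ => ?_) (fun b hb => ?_) (fun _ _ => rfl)
  · rw [Finset.mem_filter]
    exact ⟨Finset.mem_univ _, castHom_natCast_add_mul_pow n c j⟩
  · rw [val_natCast_add_mul_pow, Nat.add_mul_div_right _ _ hpn, Nat.div_eq_of_lt (ZMod.val_lt c), zero_add,
      ZMod.natCast_zmod_val]
  · rw [Finset.mem_filter, ZMod.castHom_apply, ZMod.cast_eq_val] at hb
    have hc : c.val = b.val % p ^ n := by rw [← hb.2, ZMod.val_natCast]
    have hdiv : b.val / p ^ n < p := (Nat.div_lt_iff_lt_mul hpn).mpr ((ZMod.val_lt b).trans_eq (pow_succ' p n))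
    have hval : ((b.val / p ^ n : ℕ) : ZMod p).val = b.val / p ^ n := by
      rw [ZMod.val_natCast, Nat.mod_eq_of_lt hdiv]
    rw [hval, hc, Nat.mod_add_div' b.val (p ^ n), ZMod.natCast_zmod_val]

end Fibre

/-! ### The masses of an ordinary eigensymbol -/

section OrdMass

variable {k N : ℕ} (hpN : p ∣ N) (u : ℤ_[p]ˣ)

/-- **The masses `μ_{x,y}(c + pⁿℤ_p) = u⁻ⁿ · m₀((Φ̂|β_{c,n})(x, y))`** of a `D̂_k`-valued function of pairs of
cusps. [cite: MazurTateTeitelbaum1986Invent, §I.11] -/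
def ordMass (Φ : P1Q → P1Q → HatD p k) (x y : P1Q) : (n : ℕ) → ZMod (p ^ n) → ℚ_[p] :=
  fun n c => (((u⁻¹ : ℤ_[p]ˣ) : ℤ_[p]) : ℚ_[p]) ^ n *
    hatMoment p k 0 (Nat.zero_le k) ((hatDist p k N hpN).slash (betaMat p n c.val) Φ x y)

/-- Unfolding `ordMass`. [folklore] -/
theorem ordMass_apply (Φ : P1Q → P1Q → HatD p k) (x y : P1Q) (n : ℕ) (c : ZMod (p ^ n)) :
    ordMass hpN u Φ x y n c = (((u⁻¹ : ℤ_[p]ˣ) : ℤ_[p]) : ℚ_[p]) ^ n *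
      hatMoment p k 0 (Nat.zero_le k) ((hatDist p k N hpN).slash (betaMat p n c.val) Φ x y) := rfl

/-- `‖u⁻¹‖ = 1` in `ℚ_p`. [folklore] -/
theorem norm_coe_unit_inv_eq_one : ‖(((u⁻¹ : ℤ_[p]ˣ) : ℤ_[p]) : ℚ_[p])‖ = 1 := by
  rw [PadicInt.padic_norm_e_of_padicInt]
  exact PadicInt.isUnit_iff.mp (u⁻¹).isUnit

/-- **The masses are bounded by `1`.** [folklore] -/
theorem norm_ordMass_le_one (Φ : P1Q → P1Q → HatD p k) (x y : P1Q) (n : ℕ) (c : ZMod (p ^ n)) :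
    ‖ordMass hpN u Φ x y n c‖ ≤ 1 := by
  rw [ordMass_apply, norm_mul, norm_pow, norm_coe_unit_inv_eq_one, one_pow, one_mul]
  exact norm_hatMoment_le_one _ _

/-- **Additivity of the masses over the fibres** for a `U_p`-eigenfunction `U_p Φ̂ = u Φ̂`:
`Σ_{b ↦ c} μ_{x,y}(b + pⁿ⁺¹ℤ_p) = μ_{x,y}(c + pⁿℤ_p)`. [cite: MazurTateTeitelbaum1986Invent, §I.11] -/
theorem ordMass_sum_fiber [NeZero p] {Φ : P1Q → P1Q → HatD p k} (heig : (hatDist p k N hpN).hecke N p Φ = (u : ℤ_[p]) • Φ)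
    (x y : P1Q) (n : ℕ) (c : ZMod (p ^ n)) :
    ∑ b ∈ Finset.univ.filter (fun b : ZMod (p ^ (n + 1)) => ZMod.castHom (pow_dvd_pow p n.le_succ) (ZMod (p ^ n)) b = c),
      ordMass hpN u Φ x y (n + 1) b = ordMass hpN u Φ x y n c := by
  rw [sum_fiber_castHom_eq_sum_zmod]
  simp only [ordMass_apply]
  rw [← Finset.mul_sum]
  have hkey := smul_slash_betaMat_eq_sum u hpN (hatDist p k N hpN) heig n c.val
  have hval : ∀ j : ZMod p, ((c.val + j.val * p ^ n : ℕ) : ZMod (p ^ (n + 1))).val = c.val + j.val * p ^ n :=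
    fun j => val_natCast_add_mul_pow n c j
  simp_rw [hval]
  rw [← map_sum]
  have hsum : (∑ j : ZMod p, (hatDist p k N hpN).slash (betaMat p (n + 1) (c.val + j.val * p ^ n)) Φ x y) =
      (∑ j : ZMod p, (hatDist p k N hpN).slash (betaMat p (n + 1) (c.val + j.val * p ^ n)) Φ) x y := by
    rw [Finset.sum_apply, Finset.sum_apply]
  rw [hsum, ← hkey, Pi.smul_apply, Pi.smul_apply, map_smul, pow_succ, mul_assoc]
  congr 1
  rw [Algebra.smul_def, PadicInt.algebraMap_apply, ← mul_assoc, ← PadicInt.coe_mul, Units.inv_mul, PadicInt.coe_one, one_mul]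

/-- **The masses of an ordinary eigensymbol form a `ℤ_p`-valued measure on `ℤ_p`.**
[cite: MazurTateTeitelbaum1986Invent, §I.11] -/
theorem ordMass_mem_distributionsInt [NeZero p] {Φ : P1Q → P1Q → HatD p k}
    (heig : (hatDist p k N hpN).hecke N p Φ = (u : ℤ_[p]) • Φ) (x y : P1Q) :
    ordMass hpN u Φ x y ∈ (ProfiniteTower.padicInt p).distributionsInt p := by
  refine ((ProfiniteTower.padicInt p).mem_distributionsInt_iff (p := p)).mpr
    ⟨ProfiniteTower.mem_distributions_iff.mpr ⟨fun n c => ?_, 1, fun n c => ?_⟩, fun n c => norm_ordMass_le_one hpN u Φ x y n c⟩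
  · exact ordMass_sum_fiber hpN u heig x y n c
  · exact norm_ordMass_le_one hpN u Φ x y n c

/-- **The measure `μ_{x,y} ∈ 𝔻⁰` attached to an ordinary eigensymbol and a pair of cusps.**
[cite: GreenbergStevens1993, Thm. 1.10] -/
def ordMeasure [NeZero p] {Φ : P1Q → P1Q → HatD p k} (heig : (hatDist p k N hpN).hecke N p Φ = (u : ℤ_[p]) • Φ) (x y : P1Q) : DInt p :=
  ⟨ordMass hpN u Φ x y, ordMass_mem_distributionsInt hpN u heig x y⟩

/-- The level data of `ordMeasure`. [folklore] -/
@[simp] theorem ordMeasure_val [NeZero p] {Φ : P1Q → P1Q → HatD p k} (heig : (hatDist p k N hpN).hecke N p Φ = (u : ℤ_[p]) • Φ) (x y : P1Q) :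
    (ordMeasure hpN u heig x y).1 = ordMass hpN u Φ x y := rfl

/-- **The total mass of `μ_{x,y}` is `m₀(Φ̂(x, y))`.** [folklore] -/
theorem ordMass_zero {Φ : P1Q → P1Q → HatD p k} (x y : P1Q) (c : ZMod (p ^ 0)) :
    ordMass hpN u Φ x y 0 c = hatMoment p k 0 (Nat.zero_le k) (Φ x y) := by
  rw [ordMass_apply, pow_zero, one_mul]
  have hc : c.val = 0 := by
    have := ZMod.val_lt c
    simp only [pow_zero] at this
    omega
  rw [hc, betaMat_zero_zero, (hatDist p k N hpN).slash_one]
  rfl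

end OrdMass

end Literature.NumberTheory.EllipticCurves

end
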